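import Summits.BirchSwinnertonDyer.BirchSwinnertonDyer.Theorems.PrintX11aLowerHalfOddPrimeStub
import Literature.NumberTheory.EllipticCurves.SkinnerUrban2014.RationalEqualityHidaMember
import HarnessLib

/-!
# Crux `X11aLowerHalf` (item stmt-BirchSwinnertonDyer-19064), `p = 3`: the lower half at a deep X11a pair at
# `3` FROM NAMED PUBLISHED FACTS ALONE on the sub-locus «some good-ordinary member of `H(E[3])` has a prime
# `q ∥ level` at which `E` is additive» — Skinner–Urban's Thm. 3.6.4 for that member supplies
# `OddChain.RatEqAtMember`, x11a line p2's theorem supplies `μ^an(E,3) = 0`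
# (`--supports stmt-BirchSwinnertonDyer-19064` helper; seat bsd-line-er5-p2 = -w3 width seat of the 19064 line)

HONEST FRAMING. Theorems only; no definition, no named fact, no `sorry`; NO route file imported. Everything is
CONDITIONAL on displayed named facts, ONE OF WHICH — `SkinnerUrban2014.thm364_rational_weightK_member_of_bdd_ofLevel_ram`
(p617369), Skinner–Urban 2014 Thm. 1 = 3.6.4 (rational part) for a member of `H(E[p])` with a (ram) prime — IS
USED HERE AT `p = 3`, WHERE THE CELL REFEREE'S FLAG `SU14-12.3.6-mu@nonsplit@3` (ACTIVE-PRINT-GAP: the printed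
proof's appeal to Vatsal's `μ`-theorem does not go through at `p = 3`; Wan's refereed repair is `p ≥ 5`) APPLIES.
So the theorems below are «from refereed print as stated», NOT «from print whose proofs are unflagged»; the
booking of this sub-locus is the planners' ∕ referee's call. BSD is not proved for any curve or class by this
file. beyond-print theorem: no (every input is a printed statement or a tree theorem).

## What

* `ratEqAtMember_of_su_of_ramPrime`, `memberRatEqAt_of_su_of_ramMember` — S–U's member instance gives
  `RatEqAtMember p g ι` for a member whose level `M` has `q ∥ M`, `q ≠ p`, `q² ∣ N`; hence `MemberRatEqAt W p`
  from the EXISTENCE of such a member («ram member»).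
* `ClassX11a.missingLowerBoundAt_three_of_mazur_of_memberRatEqAt_of_facts` — AT A PAIR: `ClassX11a W 3` +
  `MemberRatEqAt W 3` + 21 named facts ⟹ the lower half (both images; unit or deep alike; the certificate is
  x11a line p2's `MultThreeMuAn.muAnZeroAt_three_of_mult_of_irr`, modulo Mazur 1978 Cor. 4.1).
* `ClassX11a.missingLowerBoundAt_three_of_ramMember_of_facts` — **AT A PAIR: `ClassX11a W 3` + «a ram member
  exists» + 22 named facts (incl. S–U's flagged instance and Mazur's Manin constant) ⟹ `Typed.MissingLowerBoundAt W 3`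
  — NO per-pair certificate, NO unprinted statement**; and its `∀`-form `lowerThree_on_ramMember_of_facts`.

THE SUB-LOCUS (census, this seat, `pub/bsd-stepL/line-er5-p2/census/x11a3_kodaira.tsv`, N < 5·10⁵): a ram member
exists iff some prime `q` has `E[3]`-conductor exponent exactly `1` (then the minimal-tame-level members of
`H(E[3])`, level `N(ρ̄)`, qualify) — additive `q ≥ 5` of Kodaira type IV ∕ IV*, or `q = 2` with `v₂(N) = 2`:
91 of the 448 deep X11a classes at `3` (all with surjective `ρ̄_{E,3}`; 73 très ramifié at `3`, where the
weight-`4` newform of level `N(ρ̄)` is itself the member), 2609 of all 9133 X11a classes at `3`. The EXISTENCE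
of the ram member is a hypothesis here (per pair: a finite newform computation; class-wide: Diamond's refined
Serre statement + Carayol's level + a local conductor computation at a type-IV∕IV* prime — all printed, none
typed in the tree for this purpose).

References: [SkinnerUrban2014] Thm. 1 (p. 2) = Thm. 3.6.4 (p. 43), Prop. 12.3.6 (p. 202); [Wan2015] Thm. 4
(p. 4), Lemma 87, Thm. 103; [EmertonPollackWeston2006] Thm. 1, 3.1.1, 5.1.3, p. 5; [Wuthrich2014] Lemma 20,
Cor. 18–19; [Kato2004Asterisque] Thm. 12.4, §17.13; [Mazur1978] Cor. 4.1; [Miller2011LMS] Def. 1.1;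
[Diamond1995RefinedSerre] Thm. 1.1 (reading only).
-/

set_option autoImplicit false
set_option linter.dupNamespace false -- the directory name repeats the summit name (sibling precedent)

noncomputable section

open scoped Classical MatrixGroups ModularForm

open CongruenceSubgroup UpperHalfPlane WeierstrassCurve Literature.NumberTheory.EllipticCurves
  Literature.NumberTheory.EllipticCurves.ModularForms
  Literature.NumberTheory.EllipticCurves.Rank1Residual
  Literature.NumberTheory.EllipticCurves.Rank1Residual.Typed
  Literature.NumberTheory.EllipticCurves.Wuthrich2014
  Literature.NumberTheory.EllipticCurves.SteinWuthrich2013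
  Literature.NumberTheory.EllipticCurves.Greenberg1999
  Literature.NumberTheory.EllipticCurves.Kato2004
  Literature.NumberTheory.EllipticCurves.GreenbergVatsal2000
  Literature.NumberTheory.EllipticCurves.EmertonPollackWeston2006
  Literature.NumberTheory.EllipticCurves.SkinnerUrban2014
  Literature.NumberTheory.GaloisRepresentations
  Summit.BirchSwinnertonDyer.Rank1Residual
  Summit.BirchSwinnertonDyer.Rank1Residual.X1.MuLambda
  Summit.BirchSwinnertonDyer.Rank1Residual.X11a
  Summit.BirchSwinnertonDyer.Rank1Residual.X11a.LambdaNorm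
  Summit.BirchSwinnertonDyer.Rank1Residual.X11a.Chain

namespace Summit.BirchSwinnertonDyer.BirchSwinnertonDyer.Theorems.OddChain

/-! ### §7 Skinner–Urban's member instance gives `RatEqAtMember` ∕ `MemberRatEqAt` on the ram-member sub-locus -/

section SU

variable (W : WeierstrassCurve ℚ) [W.IsElliptic] [W.IsGloballyMinimal] (p : ℕ) [Fact p.Prime]

/-- **S–U's member instance ⟹ `RatEqAtMember p g ι`** for an ordinary member `(g, ι)` of `H(E[p])` (`p` odd,
`p ∥ N`, `E[p]` irreducible) whose level `M` has a prime `q ∥ M`, `q ≠ p`, with `q² ∣ N` (the fact's body IS the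
predicate's). CONDITIONAL on the flagged fact (`SU14-12.3.6-mu@nonsplit@3` at `p = 3`).
[cite: SkinnerUrban2014, Thm. 1 (p. 2) = Thm. 3.6.4 (p. 43)] -/
theorem ratEqAtMember_of_su_of_ramPrime (hSU : thm364_rational_weightK_member_of_bdd_ofLevel_ram)
    (hp2 : p ≠ 2) (hmult : W.HasMultiplicativeReductionAtPrime p) (hirr : W.HasIrreducibleModPGaloisRep p)
    {M : ℕ} [NeZero M] (hpM : ¬ p ∣ M)
    (hq : ∃ q : ℕ, q.Prime ∧ q ≠ p ∧ q ∣ M ∧ ¬ q ^ 2 ∣ M ∧ q ^ 2 ∣ W.conductorNorm ℤ)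
    {k : ℤ} (g : CuspForm (Gamma0 M) k) (ι : coeffField g →+* PadicAlgCl p)
    (hmem : IsOrdinaryMemberOfLevel W p g ι) : RatEqAtMember p g ι :=
  fun 𝔇 κ γ hκ hγ hγ' D htors G hG Dsym L hL hbd =>
    hSU W p hp2 hmult hirr hpM hq g ι hmem 𝔇 κ γ hκ hγ hγ' D htors G hG Dsym L hL hbd

/-- **`MemberRatEqAt W p` from the EXISTENCE of a «ram member»** — an ordinary member of `H(E[p])` whose level has
a prime `q ∥ M`, `q ≠ p`, `q² ∣ N` — granted S–U's member instance (`hSU`, flagged at `p = 3`).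
[cite: SkinnerUrban2014, Thm. 1 (p. 2) = Thm. 3.6.4 (p. 43)] [cite: EmertonPollackWeston2006, Intro p. 2 (H(ρ̄))] -/
theorem memberRatEqAt_of_su_of_ramMember (hSU : thm364_rational_weightK_member_of_bdd_ofLevel_ram)
    (hp2 : p ≠ 2) (hmult : W.HasMultiplicativeReductionAtPrime p) (hirr : W.HasIrreducibleModPGaloisRep p)
    (hram : ∃ (M : ℕ) (_ : NeZero M) (_ : ¬ p ∣ M) (k : ℤ) (g : CuspForm (Gamma0 M) k)
      (ι : coeffField g →+* PadicAlgCl p), IsOrdinaryMemberOfLevel W p g ι ∧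
      ∃ q : ℕ, q.Prime ∧ q ≠ p ∧ q ∣ M ∧ ¬ q ^ 2 ∣ M ∧ q ^ 2 ∣ W.conductorNorm ℤ) :
    MemberRatEqAt W p := by
  obtain ⟨M, instM, hpM, k, g, ι, hmem, hq⟩ := hram
  exact ⟨M, instM, hpM, k, g, ι, hmem, ratEqAtMember_of_su_of_ramPrime W p hSU hp2 hmult hirr hpM hq g ι hmem⟩

end SU

/-! ### §8 At a pair with `p = 3`: the lower half from `MemberRatEqAt W 3` ∕ from a ram member, facts only -/

section Pair

variable {W : WeierstrassCurve ℚ} [W.IsElliptic] [W.IsGloballyMinimal] {p : ℕ} [Fact p.Prime]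

/-- **AT AN X11a PAIR WITH `p = 3`: `MemberRatEqAt W p` + 21 named facts ⟹ the lower half
`Typed.MissingLowerBoundAt W p`** (both images; the certificate `μ^an(E,3) = 0` is x11a line p2's theorem
`MultThreeMuAn.muAnZeroAt_three_of_mult_of_irr` modulo Mazur 1978 Cor. 4.1 `hMz`; surjective image ⟹ `3`-adic
surjectivity by Lemma 20 `h20` and divisibility by A32 `hKato`; non-surjective ⟹ the Kato §17.13 door). PER PAIR;
CONDITIONAL; closes nothing class-wide. [cite: Mazur1978, Cor. 4.1] [cite: Wuthrich2014, Lemma 20 (p. 399), Cor. 18 (p. 398)]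
[cite: EmertonPollackWeston2006, Thm. 5.1.3] [cite: Miller2011LMS, Def. 1.1] -/
theorem _root_.Summit.BirchSwinnertonDyer.Rank1Residual.ClassX11a.missingLowerBoundAt_three_of_mazur_of_memberRatEqAt_of_facts
    (hNf : exists_isNewformOf)
    (h311 : thm311_cotorsion_weightK_member_ofLevel_odd) (hT1a : thm1_muAlg_of_weightK_member_ofLevel_odd)
    (hT1b : thm513_transfer_from_weightK_member_of_bdd_ofLevel_odd)
    (h61 : DeligneSerre1974.thm61_exists_adicGaloisRep) (h326 : Hida2000_thm326_ordinary)
    (hKato : kato_charIdeal_dvd_multiplicative_of_surjective)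
    (h20 : lemma20_surjective_threeAdic_of_semistable)
    (h12 : Kato2004.thm12_4)
    (hns : Kato2004.exists_multDivisibilityInputs_nonsplit)
    (hsp : Kato2004.exists_multDivisibilityInputs_split)
    (h15 : thm15_isTorsion_multiplicative_rat)
    (h18 : Wuthrich2014.corollary18_padicLFunction_mem_iwasawaAlgebra_multiplicative)
    (hfine : Kato2004.exists_multDivisibilityInputs_fine)
    (hJs : thm61_splitMultiplicative) (hJn : thm61_nonsplitMultiplicative)
    (hGZK : rank_eq_analyticRank_of_analyticRank_le_one)
    (hGS : greenberg_stevens (W := W) (p := p))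
    (hMz : mazur_not_dvd_maninConstant_of_odd)
    (hX : ClassX11a W p) (hp3 : p = 3) (hmem : MemberRatEqAt W p) : MissingLowerBoundAt W p := by
  obtain ⟨M, _, hpM, k, g, ι, hmemb, hRat⟩ := hmem
  have hμ : X11a.MuAnZeroAt W p := by
    subst hp3
    exact MultThreeMuAn.muAnZeroAt_three_of_mult_of_irr hMz W hX.mult hX.irr
  by_cases hsurj : Surj W p
  · have hsurj' : ∀ n : ℕ, W.HasSurjectiveModNGaloisRep (p ^ n : ℕ) := by
      subst hp3
      exact h20 W (Or.inr hX.mult) hsurj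
    exact hX.missingLowerBoundAt_of_member_of_ratEq_of_surjective_pow hNf h311 hT1a hT1b h61 h326 hKato hJs hJn
      hGZK hGS hsurj' hμ hpM g ι hmemb hRat
  · exact hX.missingLowerBoundAt_of_member_of_ratEq_of_not_surj hNf h311 hT1a hT1b h61 h326 h12 hns hsp h15 h18
      hfine hJs hJn hGZK hGS hsurj hμ hpM g ι hmemb hRat

/-- **AT AN X11a PAIR WITH `p = 3` ON THE RAM-MEMBER SUB-LOCUS: the lower half `Typed.MissingLowerBoundAt W p`
FROM 22 NAMED PUBLISHED FACTS ALONE** — the previous door with `MemberRatEqAt W 3` supplied by Skinner–Urban's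
member instance `hSU` (Thm. 3.6.4, rational, for the member with its (ram) prime; FLAG `SU14-12.3.6-mu@nonsplit@3`
ACTIVE-PRINT-GAP at `p = 3`) from the displayed EXISTENCE of a ram member `hram` (a good-ordinary member of
`H(E[3])` whose level has `q ∥ M`, `q ≠ 3`, `q² ∣ N`). No per-pair certificate, no unprinted statement; PER PAIR;
CONDITIONAL on the facts (one flagged); closes nothing class-wide by itself.
[cite: SkinnerUrban2014, Thm. 1 (p. 2) = Thm. 3.6.4 (p. 43), Prop. 12.3.6 (p. 202)] [cite: Mazur1978, Cor. 4.1]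
[cite: EmertonPollackWeston2006, Thm. 5.1.3] [cite: Miller2011LMS, Def. 1.1] -/
theorem _root_.Summit.BirchSwinnertonDyer.Rank1Residual.ClassX11a.missingLowerBoundAt_three_of_ramMember_of_facts
    (hNf : exists_isNewformOf)
    (h311 : thm311_cotorsion_weightK_member_ofLevel_odd) (hT1a : thm1_muAlg_of_weightK_member_ofLevel_odd)
    (hT1b : thm513_transfer_from_weightK_member_of_bdd_ofLevel_odd)
    (h61 : DeligneSerre1974.thm61_exists_adicGaloisRep) (h326 : Hida2000_thm326_ordinary)
    (hKato : kato_charIdeal_dvd_multiplicative_of_surjective)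
    (h20 : lemma20_surjective_threeAdic_of_semistable)
    (h12 : Kato2004.thm12_4)
    (hns : Kato2004.exists_multDivisibilityInputs_nonsplit)
    (hsp : Kato2004.exists_multDivisibilityInputs_split)
    (h15 : thm15_isTorsion_multiplicative_rat)
    (h18 : Wuthrich2014.corollary18_padicLFunction_mem_iwasawaAlgebra_multiplicative)
    (hfine : Kato2004.exists_multDivisibilityInputs_fine)
    (hJs : thm61_splitMultiplicative) (hJn : thm61_nonsplitMultiplicative)
    (hGZK : rank_eq_analyticRank_of_analyticRank_le_one)
    (hGS : greenberg_stevens (W := W) (p := p))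
    (hMz : mazur_not_dvd_maninConstant_of_odd)
    (hSU : thm364_rational_weightK_member_of_bdd_ofLevel_ram)
    (hX : ClassX11a W p) (hp3 : p = 3)
    (hram : ∃ (M : ℕ) (_ : NeZero M) (_ : ¬ p ∣ M) (k : ℤ) (g : CuspForm (Gamma0 M) k)
      (ι : coeffField g →+* PadicAlgCl p), IsOrdinaryMemberOfLevel W p g ι ∧
      ∃ q : ℕ, q.Prime ∧ q ≠ p ∧ q ∣ M ∧ ¬ q ^ 2 ∣ M ∧ q ^ 2 ∣ W.conductorNorm ℤ) :
    MissingLowerBoundAt W p :=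
  hX.missingLowerBoundAt_three_of_mazur_of_memberRatEqAt_of_facts hNf h311 hT1a hT1b h61 h326 hKato h20 h12 hns hsp
    h15 h18 hfine hJs hJn hGZK hGS hMz hp3
    (memberRatEqAt_of_su_of_ramMember W p hSU hX.ne_two hX.mult hX.irr hram)

end Pair

/-! ### §9 The `∀`-form: `stub_lowerThreeDeep` RESTRICTED to the ram-member sub-locus, from facts only -/

section SubLocus

/-- **The registered stub `stub_lowerThreeDeep` RESTRICTED TO THE RAM-MEMBER SUB-LOCUS, from 22 named
published facts + Greenberg–Stevens, NOTHING ELSE** (no certificate, no unprinted statement): for every X11a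
pair with `p = 3` (deep or not) admitting a good-ordinary member of `H(E[3])` whose level has a prime `q ∥ M`,
`q ≠ 3`, `q² ∣ N`, the lower half `ord₃ #Ш_an ≤ ord₃ #Ш` holds — granted the facts, among them Skinner–Urban's
member instance whose printed proof carries the referee's ACTIVE-PRINT-GAP flag at `p = 3`. The remaining
content of `stub_lowerThreeDeep` is then (i) the ram-member EXISTENCE on the exponent-`1` sub-locus (printed
ingredients, untyped) and (ii) `MemberRatEqAt W 3` OFF that sub-locus (357 of 448 deep classes in range; not in
print). CONDITIONAL; closes nothing by itself. [cite: SkinnerUrban2014, Thm. 1 (p. 2) = Thm. 3.6.4 (p. 43)]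
[cite: Mazur1978, Cor. 4.1] [cite: Wan2015, Thm. 4 (p. 4)] [cite: Miller2011LMS, Def. 1.1] -/
theorem lowerThree_on_ramMember_of_facts
    (hNf : exists_isNewformOf)
    (h311 : thm311_cotorsion_weightK_member_ofLevel_odd) (hT1a : thm1_muAlg_of_weightK_member_ofLevel_odd)
    (hT1b : thm513_transfer_from_weightK_member_of_bdd_ofLevel_odd)
    (h61 : DeligneSerre1974.thm61_exists_adicGaloisRep) (h326 : Hida2000_thm326_ordinary)
    (hKato : kato_charIdeal_dvd_multiplicative_of_surjective)
    (h20 : lemma20_surjective_threeAdic_of_semistable)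
    (h12 : Kato2004.thm12_4)
    (hns : Kato2004.exists_multDivisibilityInputs_nonsplit)
    (hsp : Kato2004.exists_multDivisibilityInputs_split)
    (h15 : thm15_isTorsion_multiplicative_rat)
    (h18 : Wuthrich2014.corollary18_padicLFunction_mem_iwasawaAlgebra_multiplicative)
    (hfine : Kato2004.exists_multDivisibilityInputs_fine)
    (hJs : thm61_splitMultiplicative) (hJn : thm61_nonsplitMultiplicative)
    (hGZK : rank_eq_analyticRank_of_analyticRank_le_one)
    (hGS : ∀ (W : WeierstrassCurve ℚ) [W.IsElliptic] [W.IsGloballyMinimal] (p : ℕ) [Fact p.Prime],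
      greenberg_stevens (W := W) (p := p))
    (hMz : mazur_not_dvd_maninConstant_of_odd)
    (hSU : thm364_rational_weightK_member_of_bdd_ofLevel_ram) :
    ∀ (W : WeierstrassCurve ℚ) [W.IsElliptic] [W.IsGloballyMinimal] (p : ℕ) [Fact p.Prime],
      ClassX11a W p → p = 3 →
      (∃ (M : ℕ) (_ : NeZero M) (_ : ¬ p ∣ M) (k : ℤ) (g : CuspForm (Gamma0 M) k)
        (ι : coeffField g →+* PadicAlgCl p), IsOrdinaryMemberOfLevel W p g ι ∧
        ∃ q : ℕ, q.Prime ∧ q ≠ p ∧ q ∣ M ∧ ¬ q ^ 2 ∣ M ∧ q ^ 2 ∣ W.conductorNorm ℤ) →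
      MissingLowerBoundAt W p :=
  fun W _ _ p _ hX hp3 hram =>
    hX.missingLowerBoundAt_three_of_ramMember_of_facts hNf h311 hT1a hT1b h61 h326 hKato h20 h12 hns hsp h15 h18
      hfine hJs hJn hGZK (hGS W p) hMz hSU hp3 hram

end SubLocus

end Summit.BirchSwinnertonDyer.BirchSwinnertonDyer.Theorems.OddChain

end
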